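import Literature.RepresentationTheory.Paul1998.DetCoverLiftingGeneralRank
import Literature.NumberTheory.Weil1964.ArchMetaplecticUnitarySplittingContinuity
import HarnessLib

/-!
# Paul's record (1.2.1)–(1.2.2) at EVERY real rank, WITH NO HYPOTHESIS

Topic `RepresentationTheory/Paul1998`; namespace `Literature.RepresentationTheory.Paul1998.MetaplecticSplitting`.
KERNEL ONLY: theorems; no definition, no record, no hypothesis, no `sorry`.  The two-line junction of
`DetCoverLiftingGeneralRank` (the record `(Mp₂.coverDatum P Q R S h1 h2).DetCoverLifting` at every real rank from R1, R2
and the strong continuity of the `det^{1/2}`-normalised Weil homomorphisms `weilHomV` of the two members —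
`detCoverLifting_of_continuous_weilHomV`) with `Weil1964.ArchMetaplecticUnitarySplittingContinuity` ((w1) for
`weilHomV` at every signature and real rank, `UnitaryWeil.continuous_weilHomV_apply`, from the `KAK` decomposition
`KonnoKonno2007.RealUnitaryKAK`) and `Weil1964.ArchMetaplecticDoubleCoverHolds` (R1, R2 = Folland's Theorem (4.37)).

* §1 `continuous_weilHomV` — `weilHomV : U(P,Q) → Mp^𝓢(𝕎)` is continuous (strong operator topology);
  **`continuousAt_prinSectionV`** / **`continuousAt_prinSectionW`** — the principal `det^{1/2}` sections are strongly
  continuous at every point off the branch cut of `√det`, in particular at `1`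
  (`continuousAt_prinSectionV_one`, `continuousAt_prinSectionW_one`);
* §2 **`detCoverLifting_general`** (from R1, R2) and **`detCoverLifting_general_holds`** (NO HYPOTHESIS): Paul's
  «`Ũ(p,q)` is isomorphic to the `det^{(r−s)/2}`-cover of `U(p,q)`, `Ũ(r,s)` to the `det^{(p−q)/2}`-cover, and they
  commute in `S̃p`» as the tree's record `DualPairCoverDatum.DetCoverLifting` for `S̃p = Mp₂(𝕎)` — a CONTINUOUS
  homomorphism of the fibre product of the two det-covers into the metaplectic double cover over `ι_V · ι_W` — for ALL
  finite `P, Q, R, S` with both members non-trivial, at every real rank.  The rank-one / compact statements of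
  `MetaplecticDetCoverLifting` §5–§6 are the instances `|Q|, |S| ≤ 1`.

## References

* [Paul1998] A. Paul, *Howe correspondence for real unitary groups*, J. Funct. Anal. 159 (1998) 384–431, §1.2
  (1.2.1)–(1.2.2) p. 389 L11–31.
* [Folland1989] G. B. Folland, *Harmonic Analysis in Phase Space*, Princeton UP 1989, §4.2 Thm. (4.37), p. 156 L18–30.
* [Adams2007] J. Adams, *The theta correspondence over ℝ*, World Scientific 2007, §3, Rem. 5.1.
* [Kudla1994] S. S. Kudla, *Splitting metaplectic covers of dual reductive pairs*, Israel J. Math. 87 (1994), §5.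
-/

set_option autoImplicit false

noncomputable section

open Matrix Complex MeasureTheory SchwartzMap Filter
open scoped ComplexConjugate Topology

namespace Literature.RepresentationTheory.Paul1998

namespace MetaplecticSplitting

open Literature.RepresentationTheory.KonnoKonno2007 Literature.RepresentationTheory.KonnoKonno2007.RealDualPair
open Literature.NumberTheory.Weil1964 Literature.NumberTheory.Weil1964.MpS Literature.NumberTheory.Weil1964.UnitaryBall
open Literature.NumberTheory.Weil1964.UnitaryWeil
open Literature.NumberTheory.Automorphic Literature.NumberTheory.Automorphic.UnitaryGroup
open Literature.Analysis.SegalBargmann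

variable {P Q R S : Type*} [Fintype P] [DecidableEq P] [Fintype Q] [DecidableEq Q] [Fintype R] [DecidableEq R]
  [Fintype S] [DecidableEq S]

/-! ## 1. The Weil homomorphism is strongly continuous; the principal sections are continuous off the cut -/

/-- **`weilHomV : U(P,Q) → Mp^𝓢(𝕎)` is continuous** for the strong operator topology, at every signature and real
rank. [cite: Folland1989, §4.2 p. 156 L24; Kudla1994, §5] -/
theorem continuous_weilHomV : Continuous (weilHomV P Q R S : UForm P Q → MpS (DPIdx P Q R S)) :=
  continuous_weilHomV_of_apply continuous_weilHomV_apply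

/-- **`prinSectionV` is strongly continuous at every `g` with `det(g ⊗ 1_W)` off the branch cut.**
[cite: Paul1998, §1.2 (1.2.1)–(1.2.2) p. 389 L11–31; Folland1989, §4.2 p. 156 L18–30] -/
theorem continuousAt_prinSectionV (hR1 : Folland1989_Thm_4_37_ab (DPIdx P Q R S)) {g₀ : UForm P Q}
    (hg : (mat (toBig P Q R S (g₀, 1))).det ∈ Complex.slitPlane) :
    ContinuousAt (prinSectionV (P := P) (Q := Q) (R := R) (S := S) hR1) g₀ :=
  continuousAt_prinSectionV_of_continuous hR1 continuous_weilHomV hg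

/-- **`prinSectionV` is strongly continuous at `1`.** [cite: Paul1998, §1.2 (1.2.1)–(1.2.2) p. 389 L11–31] -/
theorem continuousAt_prinSectionV_one (hR1 : Folland1989_Thm_4_37_ab (DPIdx P Q R S)) :
    ContinuousAt (prinSectionV (P := P) (Q := Q) (R := R) (S := S) hR1) 1 :=
  continuousAt_prinSectionV_one_of_continuous hR1 continuous_weilHomV

/-- **`prinSectionW` is strongly continuous at every `h` with `det(1_V ⊗ h)` off the branch cut.**
[cite: Paul1998, §1.2 (1.2.1) p. 389 L23; Folland1989, §4.2 p. 156 L18–30] -/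
theorem continuousAt_prinSectionW (hR1 : Folland1989_Thm_4_37_ab (DPIdx P Q R S)) {h₀ : UForm R S}
    (hh : (mat (toBig P Q R S (1, h₀))).det ∈ Complex.slitPlane) :
    ContinuousAt (prinSectionW (P := P) (Q := Q) (R := R) (S := S) hR1) h₀ :=
  continuousAt_prinSectionW_of_continuous hR1 continuous_weilHomV hh

/-- **`prinSectionW` is strongly continuous at `1`.** [cite: Paul1998, §1.2 (1.2.1) p. 389 L23] -/
theorem continuousAt_prinSectionW_one (hR1 : Folland1989_Thm_4_37_ab (DPIdx P Q R S)) :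
    ContinuousAt (prinSectionW (P := P) (Q := Q) (R := R) (S := S) hR1) 1 :=
  continuousAt_prinSectionW_one_of_continuous hR1 continuous_weilHomV

/-! ## 2. The record at every real rank -/

section Record

variable [Nonempty (P ⊕ Q)] [Nonempty (R ⊕ S)]

/-- **PAUL'S (1.2.1)–(1.2.2) FOR `S̃p = Mp₂(𝕎)` AT EVERY REAL RANK, FROM R1 AND R2 ALONE**: the tree's record
`DualPairCoverDatum.DetCoverLifting` for `Mp₂.coverDatum P Q R S h1 h2` — the `det^{(|R|−|S|)/2}`-cover of `U(P,Q)`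
and the `det^{(|P|−|Q|)/2}`-cover of `U(R,S)` map by a continuous homomorphism of their fibre product into `Mp₂(𝕎)`
over `ι_V · ι_W` — for ALL finite `P, Q, R, S` with both members non-trivial.
[cite: Paul1998, §1.2 (1.2.1)–(1.2.2) p. 389 L11–31; Adams2007, §3, Rem. 5.1] -/
theorem detCoverLifting_general (h1 : Folland1989_Thm_4_37_ab (DPIdx P Q R S))
    (h2 : Folland1989_Thm_4_37_c (DPIdx P Q R S)) : (Mp₂.coverDatum P Q R S h1 h2).DetCoverLifting :=
  detCoverLifting_of_continuous_weilHomV h1 h2 continuous_weilHomV continuous_weilHomV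

/-- **… WITH NO HYPOTHESIS AT ALL** (R1, R2 = `folland1989_Thm_4_37_ab_holds`, `folland1989_Thm_4_37_c_holds`):
`(Mp₂.coverDatum P Q R S R1 R2).DetCoverLifting` HOLDS at every signature `(|P|,|Q|;|R|,|S|)` and every real rank.
[cite: Paul1998, §1.2 (1.2.1)–(1.2.2) p. 389 L11–31; Folland1989, §4.2 Thm. (4.37); Adams2007, §3] -/
theorem detCoverLifting_general_holds :
    (Mp₂.coverDatum P Q R S (folland1989_Thm_4_37_ab_holds (DPIdx P Q R S))
      (folland1989_Thm_4_37_c_holds (DPIdx P Q R S))).DetCoverLifting :=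
  detCoverLifting_general _ _

end Record

end MetaplecticSplitting

end Literature.RepresentationTheory.Paul1998
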